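import Mathlib.Data.Fintype.Prod
import Literature.Combinatorics.SimpleGraph.MatchingDigraph
import HarnessLib

/-!
# A strongly connected digraph with all out-degrees ≥ 2 has a removable arc

Topic `Combinatorics/SimpleGraph`; theorems only. Tools for the hard direction of Little's theorem
(`Little1975_isPfaffianBipartite_iff_not_isMatchingMinor`, `LittleTheorem.lean`), step "choose
the last ear": in the digraph `D(G, M)` of a minimal non-Pfaffian bipartite graph (`IsArc`,
`IsStrong`, `MatchingDigraph.lean`; all out-degrees `≥ 2` because all row degrees are `≥ 3`) there
is an arc `u → v` such that `D − (u → v)` is still strongly connected, i.e. an edge `e = (u, v)`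
off the diagonal such that `G.erase e` is still connected and matching covered (the single-edge
ear of a bipartite ear decomposition, Lovász–Plummer; Little 1975 §4 builds `G_f` ear by ear).

* `exists_succ_mem_not_mem`, `exists_first_mem` — a list starting inside a set `W` and ending
  outside crosses the boundary at two consecutive positions; a list ending inside `W` has a first
  position inside `W`;
* `exists_isArc_isStrong_erase` — **if `D(G, M)` is strongly connected and every vertex has two
  out-arcs, some arc can be deleted keeping it strongly connected.** Proof ("a minimally strong
  digraph has a vertex of out-degree one"): grow a strongly connected sub-digraph `(W, E)` from a
  single vertex; either an arc of `D` with both ends in `W` is missing from `E` — add it (if this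
  completes `D`, that arc is removable) — or `W ≠ univ` and an ear can be added: an arc `x → y`
  leaving `W` followed by a shortest dipath from `y` back to `W`; the new sub-digraph is again
  strongly connected and still proper, because `y` has a second out-arc; conclude by induction on
  the number of missing vertices and arcs.

## References

* C. H. C. Little, *A characterization of convertible (0,1)-matrices*, J. Combin. Theory Ser. B
  18 (1975) 187–208, §4 (the sequence `G_f^r`). [Little1975]
* N. Robertson, P. D. Seymour, R. Thomas, *Permanents, Pfaffian orientations, and even directed
  circuits*, Ann. of Math. 150 (1999) 929–975, §7. [RobertsonSeymourThomas1999]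
-/

namespace Literature.Combinatorics.SimpleGraph

open Finset

/-! ### Two facts about lists and a set of vertices -/

section ListFacts

variable {α : Type*}

/-- A list that starts inside `W` and ends outside `W` leaves `W` between two consecutive
positions. [folklore] -/
theorem exists_succ_mem_not_mem (W : Set α) [DecidablePred (· ∈ W)] (l : List α) (hne : l ≠ [])
    (h0 : l.head hne ∈ W) (hlast : l.getLast hne ∉ W) :
    ∃ (i : ℕ) (hi : i + 1 < l.length), l[i] ∈ W ∧ l[i + 1] ∉ W := by
  classical
  have hex : ∃ m, ∃ h : m < l.length, l[m] ∉ W :=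
    ⟨l.length - 1, by have := List.length_pos_iff.2 hne; omega,
      by rwa [← List.getLast_eq_getElem hne]⟩
  let m := Nat.find hex
  obtain ⟨hm, hmW⟩ := Nat.find_spec hex
  have hm0 : m ≠ 0 := by
    intro h0'
    apply hmW
    have : l[m] = l.head hne := by simp only [h0', List.head_eq_getElem]
    rw [this]; exact h0
  refine ⟨m - 1, by omega, ?_, ?_⟩
  · by_contra hW
    exact Nat.find_min hex (show m - 1 < m by omega) ⟨by omega, hW⟩
  · have : m - 1 + 1 = m := by omega
    simp only [this]
    exact hmW

/-- A list ending inside `W` has a first position inside `W`. [folklore] -/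
theorem exists_first_mem (W : Set α) [DecidablePred (· ∈ W)] (l : List α) (hne : l ≠ [])
    (hlast : l.getLast hne ∈ W) :
    ∃ (k : ℕ) (hk : k < l.length), l[k] ∈ W ∧ ∀ (m : ℕ) (hm : m < k), l[m]'(hm.trans hk) ∉ W := by
  classical
  have hex : ∃ k, ∃ h : k < l.length, l[k] ∈ W :=
    ⟨l.length - 1, by have := List.length_pos_iff.2 hne; omega,
      by rwa [← List.getLast_eq_getElem hne]⟩
  obtain ⟨hk, hkW⟩ := Nat.find_spec hex
  exact ⟨Nat.find hex, hk, hkW, fun m hm hW => Nat.find_min hex hm ⟨hm.trans hk, hW⟩⟩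

end ListFacts

/-! ### The removable arc -/

section Removable

variable {n : ℕ} {G : Finset (Fin n × Fin n)}

/-- Reachability along a chain, from any position to the end. [folklore] -/
theorem reflTransGen_getElem_getLast {ρ : Fin n → Fin n → Prop} {Q : List (Fin n)}
    (hQ : Q.IsChain ρ) (hne : Q ≠ []) {m : ℕ} (hm : m < Q.length) :
    Relation.ReflTransGen ρ Q[m] (Q.getLast hne) := by
  have hdne : Q.drop m ≠ [] := by simp; omega
  have h := List.relationReflTransGen_of_exists_isChain (Q.drop m) (hQ.drop m) hdne
  rwa [List.getLast_drop, List.head_drop] at h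

/-- Reachability along a chain, from the start to any position. [folklore] -/
theorem reflTransGen_head_getElem {ρ : Fin n → Fin n → Prop} {Q : List (Fin n)}
    (hQ : Q.IsChain ρ) (hne : Q ≠ []) {m : ℕ} (hm : m < Q.length) :
    Relation.ReflTransGen ρ (Q.head hne) Q[m] := by
  have htne : Q.take (m + 1) ≠ [] := by simp [hne]
  have h := List.relationReflTransGen_of_exists_isChain (Q.take (m + 1)) (hQ.take (m + 1)) htne
  rw [List.head_take, List.getLast_eq_getElem] at h
  simp only [List.length_take, List.getElem_take] at h
  have hmin : min (m + 1) Q.length - 1 = m := by omega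
  simp only [hmin] at h
  exact h

/-- Reachability is monotone in the relation. [folklore] -/
theorem reflTransGen_of_imp {α : Type*} {r p : α → α → Prop} (hrp : ∀ a b, r a b → p a b)
    {a b : α} (h : Relation.ReflTransGen r a b) : Relation.ReflTransGen p a b := by
  induction h with
  | refl => exact Relation.ReflTransGen.refl
  | tail _ hbc ih => exact ih.tail (hrp _ _ hbc)

/-- **A strongly connected `D(G, M)` in which every vertex has two out-arcs has a removable
arc**: an arc `u → v` such that `D − (u → v)`, i.e. `D(G.erase (u, v), M)`, is still strongly
connected (equivalently: a minimally strongly connected digraph has a vertex of out-degree one).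
[folklore] -/
theorem exists_isArc_isStrong_erase (hs : IsStrong G) (x₀ : Fin n)
    (hout : ∀ x : Fin n, ∃ y₁ y₂, y₁ ≠ y₂ ∧ IsArc G x y₁ ∧ IsArc G x y₂) :
    ∃ u v, IsArc G u v ∧ IsStrong (G.erase (u, v)) := by
  classical
  -- all arcs
  set A : Finset (Fin n × Fin n) := Finset.univ.filter fun e => IsArc G e.1 e.2 with hAdef
  have hA : ∀ e : Fin n × Fin n, e ∈ A ↔ IsArc G e.1 e.2 := fun e => by simp [hAdef]
  -- the induction on the number of missing arcs and vertices of a strongly connected sub-digraph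
  suffices main : ∀ (μ : ℕ) (W : Finset (Fin n)) (E : Finset (Fin n × Fin n)),
      (A.card - E.card) + (n - W.card) = μ → E ⊆ A → (∀ e ∈ E, e.1 ∈ W ∧ e.2 ∈ W) → W.Nonempty →
      (∀ x ∈ W, ∀ y ∈ W, Relation.ReflTransGen (fun a b => (a, b) ∈ E) x y) →
      ¬ (W = Finset.univ ∧ E = A) → ∃ u v, IsArc G u v ∧ IsStrong (G.erase (u, v)) by
    refine main _ {x₀} ∅ rfl (Finset.empty_subset _) (fun e he => absurd he (Finset.notMem_empty _))
      ⟨x₀, Finset.mem_singleton_self _⟩ (fun x hx y hy => ?_) ?_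
    · rw [Finset.mem_singleton] at hx hy
      subst hx hy
      exact Relation.ReflTransGen.refl
    · rintro ⟨huniv, -⟩
      obtain ⟨y₁, y₂, hne, h₁, -⟩ := hout x₀
      have : y₁ ∈ ({x₀} : Finset (Fin n)) := by rw [huniv]; exact Finset.mem_univ _
      rw [Finset.mem_singleton] at this
      exact h₁.1 this.symm
  intro μ
  induction μ using Nat.strong_induction_on with
  | _ μ ih =>
  intro W E hμ hEA hEW hWne hstrong hfull
  by_cases hcase : ∃ e ∈ A, e ∉ E ∧ e.1 ∈ W ∧ e.2 ∈ W
  · -- add a missing arc inside `W`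
    obtain ⟨e, heA, heE, he1, he2⟩ := hcase
    set E' := insert e E with hE'
    have hE'A : E' ⊆ A := Finset.insert_subset heA hEA
    have hstrong' : ∀ x ∈ W, ∀ y ∈ W, Relation.ReflTransGen (fun a b => (a, b) ∈ E') x y := by
      intro x hx y hy
      exact reflTransGen_of_imp (fun a b hab => Finset.mem_insert_of_mem hab) (hstrong x hx y hy)
    by_cases hfull' : W = Finset.univ ∧ E' = A
    · -- `e` is removable
      obtain ⟨hW, hE'eq⟩ := hfull'
      refine ⟨e.1, e.2, (hA e).1 heA, fun x y => ?_⟩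
      have hxy := hstrong x (hW ▸ Finset.mem_univ x) y (hW ▸ Finset.mem_univ y)
      refine reflTransGen_of_imp (fun a b hab => ?_) hxy
      rw [isArc_erase_iff]
      refine ⟨(hA _).1 (hEA hab), fun h => heE ?_⟩
      rw [Prod.ext_iff] at h
      obtain ⟨a', b'⟩ := e
      simp only at h
      rw [← h.1, ← h.2]; exact hab
    · have hcard : E'.card = E.card + 1 := Finset.card_insert_of_notMem heE
      have hle : E'.card ≤ A.card := Finset.card_le_card hE'A
      exact ih _ (by omega) W E' rfl hE'A
        (fun f hf => by
          rcases Finset.mem_insert.1 hf with rfl | hf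
          · exact ⟨he1, he2⟩
          · exact hEW f hf) hWne hstrong' hfull'
  · -- every arc inside `W` is present: add an ear
    have hcase' : ∀ e ∈ A, e ∉ E → e.1 ∈ W → e.2 ∉ W := fun e he heE he1 he2 =>
      hcase ⟨e, he, heE, he1, he2⟩
    have hWuniv : W ≠ Finset.univ := by
      intro hW
      apply hfull ⟨hW, Finset.Subset.antisymm hEA fun e he => ?_⟩
      by_contra heE
      exact absurd (Finset.mem_univ e.2) (hW ▸ hcase' e he heE (hW ▸ Finset.mem_univ _))
    obtain ⟨t, ht⟩ : ∃ t, t ∉ W := by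
      by_contra h
      exact hWuniv (Finset.eq_univ_iff_forall.2 fun t => not_not.1 fun ht => h ⟨t, ht⟩)
    obtain ⟨w, hw⟩ := hWne
    -- an arc `x → y` leaving `W`
    obtain ⟨l₁, hc₁, -, hlast₁⟩ := hs.exists_path w t
    obtain ⟨i, hi, hxW, hyW⟩ := exists_succ_mem_not_mem (W : Set (Fin n)) (w :: l₁)
      (List.cons_ne_nil _ _) (by simpa using hw) (by rw [hlast₁]; simpa using ht)
    set x := (w :: l₁)[i] with hxdef
    set y := (w :: l₁)[i + 1] with hydef
    have hxy : IsArc G x y := List.isChain_iff_getElem.1 hc₁ i hi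
    -- a shortest dipath from `y` back to `W`
    obtain ⟨l₂, hc₂, hnd₂, hlast₂⟩ := hs.exists_path y w
    obtain ⟨k, hk, hkW, hfirst⟩ := exists_first_mem (W : Set (Fin n)) (y :: l₂)
      (List.cons_ne_nil _ _) (by rw [hlast₂]; simpa using hw)
    have hk0 : k ≠ 0 := by
      rintro rfl
      exact hyW (by simpa using hkW)
    set Q := (y :: l₂).take (k + 1) with hQdef
    have hQne : Q ≠ [] := by simp [hQdef]
    have hQlen : Q.length = k + 1 := by
      rw [hQdef, List.length_take]
      exact Nat.min_eq_left hk
    have hQget : ∀ (m : ℕ) (hm : m < Q.length), Q[m] = (y :: l₂)[m]'(by rw [hQlen] at hm; omega) :=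
      fun m hm => by simp only [hQdef, List.getElem_take]
    have hQchain : Q.IsChain (IsArc G) := hc₂.take (k + 1)
    have hQnd : Q.Nodup := hnd₂.sublist (List.take_sublist _ _)
    have hQhead : Q.head hQne = y := by rw [List.head_eq_getElem, hQget]; rfl
    have hQlastW : Q.getLast hQne ∈ W := by
      rw [List.getLast_eq_getElem, hQget]
      simpa [hQlen] using hkW
    have hQint : ∀ (m : ℕ) (hm : m < k), Q[m]'(by rw [hQlen]; omega) ∉ W := by
      intro m hm hW
      rw [hQget] at hW
      exact hfirst m hm (by simpa using hW)
    -- the new sub-digraph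
    set W' : Finset (Fin n) := W ∪ Q.toFinset with hW'
    set E' : Finset (Fin n × Fin n) := insert (x, y) (E ∪ (Q.zip Q.tail).toFinset) with hE'
    have hEE' : E ⊆ E' := fun f hf =>
      Finset.mem_insert_of_mem (Finset.mem_union_left _ hf)
    have hQarcs : ∀ p ∈ Q.zip Q.tail, IsArc G p.1 p.2 := by
      intro p hp
      obtain ⟨j, hj, rfl⟩ := List.getElem_of_mem hp
      simp only [List.length_zip, List.length_tail] at hj
      rw [List.getElem_zip]
      simp only [List.getElem_tail]
      exact List.isChain_iff_getElem.1 hQchain j (by omega)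
    have hQzip_index : ∀ p ∈ Q.zip Q.tail, ∃ (j : ℕ) (hj : j + 1 < Q.length),
        Q[j] = p.1 ∧ Q[j + 1] = p.2 := by
      intro p hp
      obtain ⟨j, hj, hjp⟩ := List.getElem_of_mem hp
      simp only [List.length_zip, List.length_tail] at hj
      refine ⟨j, by omega, ?_, ?_⟩
      · rw [← hjp, List.getElem_zip]
      · rw [← hjp, List.getElem_zip]; simp
    have hE'A : E' ⊆ A := by
      intro f hf
      rcases Finset.mem_insert.1 hf with rfl | hf
      · exact (hA _).2 hxy
      · rcases Finset.mem_union.1 hf with hf | hf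
        · exact hEA hf
        · exact (hA f).2 (hQarcs f (List.mem_toFinset.1 hf))
    have hyQ : y ∈ Q := by rw [← hQhead]; exact List.head_mem hQne
    have hE'W : ∀ f ∈ E', f.1 ∈ W' ∧ f.2 ∈ W' := by
      intro f hf
      rcases Finset.mem_insert.1 hf with rfl | hf
      · exact ⟨Finset.mem_union_left _ (by simpa [hxdef] using hxW),
          Finset.mem_union_right _ (List.mem_toFinset.2 hyQ)⟩
      · rcases Finset.mem_union.1 hf with hf | hf
        · exact ⟨Finset.mem_union_left _ (hEW f hf).1, Finset.mem_union_left _ (hEW f hf).2⟩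
        · have h12 := List.of_mem_zip (List.mem_toFinset.1 hf)
          exact ⟨Finset.mem_union_right _ (List.mem_toFinset.2 h12.1),
            Finset.mem_union_right _ (List.mem_toFinset.2 (List.mem_of_mem_tail h12.2))⟩
    -- reachability in the new sub-digraph
    have hρ_mono : ∀ a b, Relation.ReflTransGen (fun a b => (a, b) ∈ E) a b →
        Relation.ReflTransGen (fun a b => (a, b) ∈ E') a b := fun a b h =>
      reflTransGen_of_imp (fun a b hab => hEE' hab) h
    have hQchain' : Q.IsChain (fun a b => (a, b) ∈ E') := by
      rw [List.isChain_iff_getElem]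
      intro j hj
      apply Finset.mem_insert_of_mem
      apply Finset.mem_union_right
      rw [List.mem_toFinset, List.mem_iff_getElem]
      refine ⟨j, by simp; omega, ?_⟩
      rw [List.getElem_zip]; simp
    have hy_to : ∀ q ∈ Q, Relation.ReflTransGen (fun a b => (a, b) ∈ E') y q := by
      intro q hq
      obtain ⟨m, hm, rfl⟩ := List.getElem_of_mem hq
      rw [← hQhead]
      exact reflTransGen_head_getElem hQchain' hQne hm
    have hto_last : ∀ q ∈ Q, Relation.ReflTransGen (fun a b => (a, b) ∈ E') q (Q.getLast hQne) := by
      intro q hq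
      obtain ⟨m, hm, rfl⟩ := List.getElem_of_mem hq
      exact reflTransGen_getElem_getLast hQchain' hQne hm
    have hxy' : Relation.ReflTransGen (fun a b => (a, b) ∈ E') x y :=
      Relation.ReflTransGen.single (Finset.mem_insert_self _ _)
    have hxW' : x ∈ W := by simpa [hxdef] using hxW
    have hstrong' : ∀ a ∈ W', ∀ b ∈ W', Relation.ReflTransGen (fun a b => (a, b) ∈ E') a b := by
      intro a ha b hb
      rcases Finset.mem_union.1 ha with ha | ha <;> rcases Finset.mem_union.1 hb with hb | hb
      · exact hρ_mono a b (hstrong a ha b hb)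
      · exact (hρ_mono a x (hstrong a ha x hxW')).trans (hxy'.trans (hy_to b (List.mem_toFinset.1 hb)))
      · exact (hto_last a (List.mem_toFinset.1 ha)).trans (hρ_mono _ b (hstrong _ hQlastW b hb))
      · exact (hto_last a (List.mem_toFinset.1 ha)).trans
          ((hρ_mono _ x (hstrong _ hQlastW x hxW')).trans (hxy'.trans (hy_to b (List.mem_toFinset.1 hb))))
    -- the new sub-digraph is still proper: `y` has a second out-arc
    have hnotfull' : ¬ (W' = Finset.univ ∧ E' = A) := by
      rintro ⟨-, hE'eq⟩
      obtain ⟨y₁, y₂, hne12, h₁, h₂⟩ := hout y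
      have h2Q : 1 < Q.length := by rw [hQlen]; omega
      obtain ⟨y', hy'z, hy'⟩ : ∃ y', y' ≠ Q[1] ∧ IsArc G y y' := by
        by_cases h : y₁ = Q[1]
        · exact ⟨y₂, fun h' => hne12 (h.trans h'.symm), h₂⟩
        · exact ⟨y₁, h, h₁⟩
      have hmem : (y, y') ∈ E' := by rw [hE'eq]; exact (hA _).2 hy'
      rcases Finset.mem_insert.1 hmem with heq | hmem
      · have : y = x := (Prod.ext_iff.1 heq).1
        exact hyW (by rw [this]; simpa [hxdef] using hxW)
      · rcases Finset.mem_union.1 hmem with hmem | hmem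
        · exact hyW (by simpa using (hEW _ hmem).1)
        · obtain ⟨j, hj, hj1, hj2⟩ := hQzip_index _ (List.mem_toFinset.1 hmem)
          simp only at hj1 hj2
          have hj0 : j = 0 := by
            have h0 : Q[0] = y := by rw [← List.head_eq_getElem]; exact hQhead
            exact (hQnd.getElem_inj_iff.1 (hj1.trans h0.symm))
          subst hj0
          exact hy'z hj2.symm
    -- the measure decreases
    have hlt : (A.card - E'.card) + (n - W'.card) < μ := by
      have h1 : W.card < W'.card := by
        apply Finset.card_lt_card
        refine ⟨Finset.subset_union_left, fun h => hyW ?_⟩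
        simpa using h (Finset.mem_union_right _ (List.mem_toFinset.2 hyQ))
      have h2 : E.card ≤ E'.card := Finset.card_le_card hEE'
      have h3 : E'.card ≤ A.card := Finset.card_le_card hE'A
      have h4 : W'.card ≤ n := by simpa using Finset.card_le_univ W'
      omega
    exact ih _ (hμ ▸ hlt) W' E' rfl hE'A hE'W ⟨w, Finset.mem_union_left _ hw⟩ hstrong' hnotfull'

end Removable

end Literature.Combinatorics.SimpleGraph
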